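import Literature.AlgebraicGeometry.Resolution.RsopLocalization
import Literature.AlgebraicGeometry.Resolution.CurveCentreNearPointGammaPrime
import Literature.AlgebraicGeometry.Resolution.CurveCentreNearPointDimension
import Literature.AlgebraicGeometry.Resolution.GenericPointStalkData
import HarnessLib

/-!
# [CoP1] Lemma 4.3 (4), the curve `Γ′` (F-71 stub T2b′) — second helper file: the QUOTIENT STEP.  `Γ′` is regular as soon
# as, at each of its points `z`, the prime `𝔭_{η′} ⊂ 𝒪_{X′,z}` contains a pair that is part of a regular system of parameters

Topic: `Literature/AlgebraicGeometry/Resolution`. Sequel of `CurveCentreNearPointGammaPrime.lean` (clauses 2–3 of the stub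
`stub_T2b'_isRegular_gammaPrime` and the reduction of clause 1 to the quotient stalks `𝒪_{X′,z}/𝔭_{η′}`).  Here, fact-free:

* `IsRsopPart.span_range_eq_of_le_of_height_le` / `IsRsopPart.isRegularLocalRing_quotient_of_le_of_height_le` — pure local
  algebra: a prime of height `≤ n` containing `n` elements of a regular system of parameters IS the ideal they generate, and the
  quotient by it is a regular local ring (Matsumura Thm. 14.2 + strict monotonicity of heights of primes);
* `exists_isRsopPart_fin_two_of_closure_eq` — at the generic point `η` of the regular irreducible codimension-`2` centre `Y`,
  `𝓘_{Y,η} = 𝔪_η` is a regular system of parameters of length `2`;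
* `IsBlowup.coheight_eq_two_of_isNear_curve_generic` — **a near point `η′` over `η` has codimension `2`** ([CoP1] Lemma 4.3 (4):
  `𝒪_{X′,η′}` is regular of the embedding dimension of `𝒪_{X,η}`, p616045);
* `IsBlowup.isRegularLocalRing_stalk_quotient_of_isRsopPart_le` — hence at a point `z` of `Γ′ = cl{η′}`, ANY rsop pair inside
  `𝔭_{η′}` generates it and `𝒪_{X′,z}/𝔭_{η′}` is regular;
* `IsBlowup.isRegular_gammaPrime_of_forall_exists_isRsopPart` — the stub's three clauses (binders and conclusion VERBATIM) MODULO
  `hpair : ∀ z, η′ ⤳ z → z ≠ η′ → ∃ v : Fin 2 → 𝒪_{X′,z}, IsRsopPart v ∧ (v₀, v₁) ⊆ 𝔭_{η′}`.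

What remains for the stub (NOT here): the pair itself — [CoP1] p. 10 L11–12 «x′ := (y₁′ = y₁, y₂′ = y₂/y₁, y₃)»: `v = (π♯c_j, t − π♯a)`
with `t` the chart parameter of p616045 (`IsBlowup.exists_chart_rsop_of_isNear_curve_of_adapted`) and `a ∈ 𝒪_{X,x}` a lift of the
direction of the near point `η′` at the generic point (it lies in `𝒪_{Y,x}` by normality of the regular `Y`).  [OURS plumbing for
cell res-hironaka W4.5a crux F-71; prover res-inputs-p-6.]  NOT a statement of any manuscript under review (Hironaka 2017).
AI-written; weaker than expert review.

## Sources
* V. Cossart, O. Piltant, J. Algebra 320 (2008), Lemma 4.3 (4) [p. 9 L42–43], proof of Prop. 4.4 [p. 10 L11–12]. [CossartPiltant2008]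
* H. Matsumura, *Commutative Ring Theory* (1986), Thm. 14.2. [Matsumura1987]
-/

noncomputable section

open CategoryTheory AlgebraicGeometry TopologicalSpace IsLocalRing

namespace Literature.AlgebraicGeometry.Resolution

universe u

/-- **A prime of height `≤ n` containing `n` elements that are part of a regular system of parameters is generated by
them.** In a local ring `R`, if `v : Fin n → R` is part of a regular system of parameters, `P` is prime,
`(v_0, …, v_{n-1}) ⊆ P` and `ht P ≤ n`, then `P = (v_0, …, v_{n-1})` — the ideal `(v_i)_i` is a prime of height `n`
(`IsRsopPart.isPrime_span_range`, `IsRsopPart.height_span_range`) and heights of primes increase strictly along strict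
inclusions. [cite: Matsumura1987, Thm. 14.2 (regular system of parameters: `R/(x_1,…,x_i)` regular of dimension `d − i`)] -/
theorem IsRsopPart.span_range_eq_of_le_of_height_le {R : Type u} [CommRing R] [IsLocalRing R] {n : ℕ}
    {v : Fin n → R} (hv : IsRsopPart v) {P : Ideal R} [P.IsPrime]
    (hle : Ideal.span (Set.range v) ≤ P) (hP : P.height ≤ n) : Ideal.span (Set.range v) = P := by
  haveI := hv.isRegularLocalRing
  haveI := hv.isPrime_span_range
  by_contra hne
  have hlt : Ideal.span (Set.range v) < P := lt_of_le_of_ne hle hne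
  have h := Ideal.height_strict_mono_of_isPrime_of_isPrime hlt
  rw [hv.height_span_range] at h
  exact lt_irrefl _ (lt_of_lt_of_le h hP)

/-- **Hence the quotient by such a prime is a regular local ring** (`R/(v_i)_i` is regular for an rsop part `v`,
`IsRsopPart.isRegularLocalRing_quotient`). [cite: Matsumura1987, Thm. 14.2] -/
theorem IsRsopPart.isRegularLocalRing_quotient_of_le_of_height_le {R : Type u} [CommRing R] [IsLocalRing R]
    {n : ℕ} {v : Fin n → R} (hv : IsRsopPart v) {P : Ideal R} [P.IsPrime]
    (hle : Ideal.span (Set.range v) ≤ P) (hP : P.height ≤ n) : IsRegularLocalRing (R ⧸ P) := by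
  obtain rfl := hv.span_range_eq_of_le_of_height_le hle hP
  exact hv.isRegularLocalRing_quotient


open Scheme.IdealSheafData

variable {X X' : Scheme.{u}} {π : X' ⟶ X}

/-- **At the generic point `η` of a regular irreducible closed subset `Y = cl{η}` of codimension `2`, `𝓘_{Y,η} = 𝔪_η` is
generated by a pair that is part of (indeed is) a regular system of parameters of `𝒪_{X,η}`.**
[cite: CossartPiltant2008, Lemma 4.3 (4)] -/
theorem exists_isRsopPart_fin_two_of_closure_eq [IsLocallyNoetherian X] {Y : Closeds X}
    (hreg : Scheme.IsRegular (vanishingIdeal Y).subscheme) {η : X} (hY : (Y : Set X) = closure {η})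
    (hcodim : Order.coheight η = 2) [IsRegularLocalRing (X.presheaf.stalk η)] :
    ∃ c : Fin 2 → X.presheaf.stalk η, IsRsopPart c ∧
      Ideal.span (Set.range c) = stalkIdeal (vanishingIdeal Y) η := by
  have hηY : η ∈ (Y : Set X) := by
    rw [hY]
    exact subset_closure rfl
  obtain ⟨r, c, hcr, hcY⟩ := exists_isRsopPart_span_range_eq_stalkIdeal_of_mem_closeds hreg hηY
  have hm : stalkIdeal (vanishingIdeal Y) η = maximalIdeal _ :=
    stalkIdeal_vanishingIdeal_eq_maximalIdeal_of_closure_eq hY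
  have hq := hcr.ringKrullDim_quotient_add
  rw [hcY, hm] at hq
  have hdim : ringKrullDim (X.presheaf.stalk η) = 2 := by
    rw [ringKrullDim_stalk_eq_coheight, hcodim]
    rfl
  have h0 : ringKrullDim (X.presheaf.stalk η ⧸ maximalIdeal (X.presheaf.stalk η)) = 0 := by
    letI : Field (X.presheaf.stalk η ⧸ maximalIdeal (X.presheaf.stalk η)) :=
      Ideal.Quotient.field (maximalIdeal (X.presheaf.stalk η))
    exact ringKrullDim_eq_zero_of_isField (Field.toIsField _)
  rw [hdim, h0, zero_add] at hq
  obtain rfl : r = 2 := by exact_mod_cast hq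
  exact ⟨c, hcr, hcY⟩

/-- **A near point `η′` over the generic point of the curve centre has codimension `2`** (`𝒪_{X′,η′}` is regular of the
same embedding dimension as `𝒪_{X,η}`, [CoP1] Lemma 4.3 (4) — `IsBlowup.isRegularLocalRing_and_spanFinrank_eq_of_isNear_curve`).
[cite: CossartPiltant2008, Lemma 4.3 (4)] -/
theorem IsBlowup.coheight_eq_two_of_isNear_curve_generic [IsLocallyNoetherian X] [IsLocallyNoetherian X']
    (hX : Scheme.IsRegular X) {Y : Closeds X} (hreg : Scheme.IsRegular (vanishingIdeal Y).subscheme)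
    (hπ : IsBlowup π (vanishingIdeal Y)) {J : X.IdealSheafData} {μ : ℕ} (hμ : 1 ≤ μ)
    (hY : ∀ y ∈ (Y : Set X), idealOrder J y = μ) {η' : X'} (hη' : closure {π η'} = (Y : Set X))
    (hcodim : Order.coheight (π η') = 2) (hnear : IsNear π (vanishingIdeal Y) J μ η') :
    Order.coheight η' = 2 := by
  haveI := hX (π η')
  obtain ⟨c, hcr, hcY⟩ := exists_isRsopPart_fin_two_of_closure_eq hreg hη'.symm hcodim
  obtain ⟨hreg', hsf⟩ := hπ.isRegularLocalRing_and_spanFinrank_eq_of_isNear_curve hX hreg hμ hY hcr hcY hnear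
  have h1 : (maximalIdeal (X.presheaf.stalk (π η'))).spanFinrank = 2 :=
    spanFinrank_maximalIdeal_stalk_eq (π η') hcodim
  rw [h1] at hsf
  haveI := hreg'
  have h2 := IsRegularLocalRing.spanFinrank_maximalIdeal (R := X'.presheaf.stalk η')
  rw [hsf, ringKrullDim_stalk_eq_coheight] at h2
  have h3 : ((Order.coheight η' : ℕ∞) : WithBot ℕ∞) = (((2 : ℕ) : ℕ∞) : WithBot ℕ∞) := by
    rw [← h2]
    norm_cast
  have h4 : Order.coheight η' = ((2 : ℕ) : ℕ∞) := WithBot.coe_injective h3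
  exact_mod_cast h4

/-- **The residual of T2b′, reduced further**: at a point `z` of `Γ′ = cl{η′}` it suffices to exhibit a pair `v` that is
part of a regular system of parameters of `𝒪_{X′,z}` with `(v₀, v₁) ⊆ 𝔭_{η′}` — for then `𝔭_{η′} = (v₀, v₁)` (its height is
`codim η′ = 2`) and `𝒪_{X′,z}/𝔭_{η′}` is regular.  ([CoP1] p. 10 L11–12: `v = (y₁, y₂/y₁ − a)`.)
[cite: CossartPiltant2008, Lemma 4.3 (4)] -/
theorem IsBlowup.isRegularLocalRing_stalk_quotient_of_isRsopPart_le [IsLocallyNoetherian X]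
    [IsLocallyNoetherian X'] (hX : Scheme.IsRegular X) {Y : Closeds X}
    (hreg : Scheme.IsRegular (vanishingIdeal Y).subscheme) (hπ : IsBlowup π (vanishingIdeal Y))
    {J : X.IdealSheafData} {μ : ℕ} (hμ : 1 ≤ μ) (hY : ∀ y ∈ (Y : Set X), idealOrder J y = μ)
    {η' : X'} (hη' : closure {π η'} = (Y : Set X)) (hcodim : Order.coheight (π η') = 2)
    (hnear : IsNear π (vanishingIdeal Y) J μ η') {z : X'} (hz : η' ⤳ z)
    {v : Fin 2 → X'.presheaf.stalk z} (hv : IsRsopPart v)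
    (hle : Ideal.span (Set.range v) ≤ primeOfSpecializes hz) :
    IsRegularLocalRing (X'.presheaf.stalk z ⧸ primeOfSpecializes hz) := by
  have hc : Order.coheight η' = 2 := hπ.coheight_eq_two_of_isNear_curve_generic hX hreg hμ hY hη' hcodim hnear
  have hh := coe_height_primeOfSpecializes hz
  rw [hc] at hh
  have hP : (primeOfSpecializes hz).height ≤ 2 := by
    have : ((primeOfSpecializes hz).height : WithBot ℕ∞) = ((2 : ℕ∞) : WithBot ℕ∞) := by exact_mod_cast hh
    exact le_of_eq (by exact_mod_cast this)
  exact hv.isRegularLocalRing_quotient_of_le_of_height_le hle hP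

/-- **T2b′ MODULO the rsop pair inside `𝔭_{η′}`** at the points `z ≠ η′` of `Γ′`: binders and conclusion of the F-71 stub
`stub_T2b'_isRegular_gammaPrime` VERBATIM, plus `hpair`.  (`hYirr`, `hJ` are not used by this reduction.)
[cite: CossartPiltant2008, Lemma 4.3 (4)] -/
theorem IsBlowup.isRegular_gammaPrime_of_forall_exists_isRsopPart [IsLocallyNoetherian X]
    [IsLocallyNoetherian X'] (hX : Scheme.IsRegular X) {Y : Closeds X}
    (hYirr : IsIrreducible ((Y : Closeds X) : Set X))
    (hreg : Scheme.IsRegular (vanishingIdeal Y).subscheme) (hπ : IsBlowup π (vanishingIdeal Y))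
    {J : X.IdealSheafData} {μ : ℕ} (hμ : 1 ≤ μ) (hY : ∀ y ∈ (Y : Set X), idealOrder J y = μ)
    (hJ : ∀ x, idealOrder J x ≤ μ) {η' : X'} (hη' : closure {π η'} = (Y : Set X))
    (hcodim : Order.coheight (π η') = 2) (hnear : IsNear π (vanishingIdeal Y) J μ η')
    (hpair : ∀ (z : X') (hz : η' ⤳ z), z ≠ η' →
      ∃ v : Fin 2 → X'.presheaf.stalk z, IsRsopPart v ∧ Ideal.span (Set.range v) ≤ primeOfSpecializes hz) :
    Scheme.IsRegular (vanishingIdeal (⟨closure {η'}, isClosed_closure⟩ : Closeds X')).subscheme ∧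
      (∀ z ∈ closure ({η'} : Set X'), IsNear π (vanishingIdeal Y) J μ z) ∧
      π '' closure ({η'} : Set X') = (Y : Set X) :=
  hπ.isRegular_gammaPrime_of_forall_quotient hX hYirr hreg hμ hY hJ hη' hcodim hnear fun z hz hne => by
    obtain ⟨v, hv, hle⟩ := hpair z hz hne
    exact hπ.isRegularLocalRing_stalk_quotient_of_isRsopPart_le hX hreg hμ hY hη' hcodim hnear hz hv hle

end Literature.AlgebraicGeometry.Resolution

end
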